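import Mathlib
import Literature.NumberTheory.LFunctions.Zhang2022.TypedSection17Identities
import HarnessLib

/-!
# Zhang (2022), §17.u023 / G-L4t6-1a "Swap17": the pointwise swap `χ(m)κ̄₂(m) ↔ ϱ*₁(m)` — lemmas

Topic `Literature/NumberTheory/LFunctions/Zhang2022` (Landau–Siegel audit tree; verdict-neutral).
Y. Zhang, arXiv:2211.02515v1 (2022) [Zhang2022LandauSiegel] — an unrefereed manuscript under
adjudication; nothing here bears on its Theorems 1–2. §17 p.98 (tex L4830–4838) invokes Lemma 15.1
"(see (15.))" for the sum `Σ_{(m₁,𝔮)=1} b(l₁m₁)κ̄₂(m₁)/m₁`, whose weight `κ̄₂ = conj κ₂`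
(`κ₂ = n^{−β₁} ∗ μ`, §16) is NOT Lemma 15.1's `χ(m)ϱ*₁(m)` (`ϱ*₁(m) = Σ_{d∣m} d^{β₁}χ(d)`, (15.21)).
The cell's repair (GAP row G-L4t6-1a) swaps the weights at the cost `O(𝓛⁻⁸τ₂(l₁))` by the mechanism
of (B.1) (App. B p.106, tex L5256–5266). This file proves the POINTWISE part:

* `norm_moebius_mul_chi_sub_one_le` — `|μ(e)χ(e) − 1| ≤ Σ_{h∣e, h>1} |ν(h)|` (`ν = 1 ∗ χ`), from the
  Dirichlet identity `μχ ∗ ν = (μχ ∗ χ) ∗ 1 = 1` (`χ ∗ μχ = δ`, the tree's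
  `Typed.Section17.toArithmeticFunction_chi_mul_moebiusChi`);
* `norm_chi_mul_kappa2bar_sub_varrhoStar_le` — `χ(m)κ̄₂(m) − ϱ*₁(m) = Σ_{de=m} d^{β₁}χ(d)(μ(e)χ(e) − 1)`,
  hence `|χ(m)κ̄₂(m) − ϱ*₁(m)| ≤ Σ_{e∣m} Σ_{h∣e, h>1} |ν(h)|`.

The summation (Lemma 3.1 + Cauchy–Schwarz) is in `Section17Swap`. [cite: Zhang2022LandauSiegel, §17 p.98; App. B p.106]
-/

noncomputable section

open Complex Real ComplexConjugate Finset

namespace Literature.NumberTheory.LFunctions.Zhang2022.Skeleton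

section Pointwise

variable {D : ℕ} (χ : DirichletCharacter ℂ D)

/-- **`μχ ∗ ν = 1`**: for `e ≥ 1`, `Σ_{ab=e} μ(a)χ(a)ν(b) = 1` (`ν = 1 ∗ χ`; `χ ∗ μχ = δ` since `χ` is
completely multiplicative). [cite: Zhang2022LandauSiegel, App. B p.106] -/
theorem sum_moebiusChi_mul_nu_eq_one {e : ℕ} (he : e ≠ 0) :
    ∑ x ∈ e.divisorsAntidiagonal,
      (ArithmeticFunction.moebius x.1 : ℂ) * χ (x.1 : ZMod D) * divisorSumChar χ x.2 = 1 := by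
  set X : ArithmeticFunction ℂ := toArithmeticFunction (fun k : ℕ => χ (k : ZMod D)) with hX
  set MX : ArithmeticFunction ℂ :=
    toArithmeticFunction (fun k : ℕ => (ArithmeticFunction.moebius k : ℂ) * χ (k : ZMod D)) with hMX
  set Z : ArithmeticFunction ℂ := ((ArithmeticFunction.zeta : ArithmeticFunction ℕ) : ArithmeticFunction ℂ)
    with hZ
  have hXMX : X * MX = 1 := Typed.Section17.toArithmeticFunction_chi_mul_moebiusChi χ
  have hprod : MX * (X * Z) = Z := by
    rw [← mul_assoc, mul_comm MX X, hXMX, one_mul]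
  have hnu : ∀ b : ℕ, b ≠ 0 → (X * Z) b = divisorSumChar χ b := by
    intro b hb
    rw [hZ, ArithmeticFunction.coe_mul_zeta_apply, divisorSumChar_apply]
    refine Finset.sum_congr rfl fun d hd => ?_
    have hd0 : d ≠ 0 := (Nat.pos_of_mem_divisors hd).ne'
    simp [hX, toArithmeticFunction, hd0]
  have h := congrArg (fun f : ArithmeticFunction ℂ => f e) hprod
  rw [ArithmeticFunction.mul_apply] at h
  rw [hZ, ArithmeticFunction.natCoe_apply, ArithmeticFunction.zeta_apply_ne he, Nat.cast_one] at h
  rw [← h]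
  refine Finset.sum_congr rfl fun x hx => ?_
  obtain ⟨hxe, _⟩ := Nat.mem_divisorsAntidiagonal.mp hx
  have hx1 : x.1 ≠ 0 := left_ne_zero_of_mul (hxe ▸ he)
  have hx2 : x.2 ≠ 0 := right_ne_zero_of_mul (hxe ▸ he)
  rw [hnu x.2 hx2]
  simp [hMX, toArithmeticFunction, hx1]

/-- **`|μ(e)χ(e) − 1| ≤ Σ_{h∣e, h>1} |ν(h)|`** for `e ≥ 1` (the `b = 1` term of `μχ ∗ ν = 1` is
`μ(e)χ(e)`, every other term has modulus `≤ |ν(b)|`). [cite: Zhang2022LandauSiegel, App. B p.106] -/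
theorem norm_moebius_mul_chi_sub_one_le {e : ℕ} (he : e ≠ 0) :
    ‖(ArithmeticFunction.moebius e : ℂ) * χ (e : ZMod D) - 1‖ ≤
      ∑ h ∈ e.divisors.erase 1, ‖divisorSumChar χ h‖ := by
  have hid := sum_moebiusChi_mul_nu_eq_one χ he
  have hmem : (e, 1) ∈ e.divisorsAntidiagonal := Nat.mem_divisorsAntidiagonal.mpr ⟨mul_one e, he⟩
  rw [← Finset.add_sum_erase _ _ hmem] at hid
  simp only [divisorSumChar_one, mul_one] at hid
  have hdiff : (ArithmeticFunction.moebius e : ℂ) * χ (e : ZMod D) - 1 =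
      -∑ x ∈ (e.divisorsAntidiagonal).erase (e, 1),
        (ArithmeticFunction.moebius x.1 : ℂ) * χ (x.1 : ZMod D) * divisorSumChar χ x.2 := by
    rw [← hid]; ring
  rw [hdiff, norm_neg]
  refine (norm_sum_le _ _).trans ?_
  have hterm : ∀ x ∈ (e.divisorsAntidiagonal).erase (e, 1),
      ‖(ArithmeticFunction.moebius x.1 : ℂ) * χ (x.1 : ZMod D) * divisorSumChar χ x.2‖ ≤
        ‖divisorSumChar χ x.2‖ := by
    intro x _
    rw [norm_mul, norm_mul]
    have hμ : ‖(ArithmeticFunction.moebius x.1 : ℂ)‖ ≤ 1 := by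
      rw [Complex.norm_intCast]; exact_mod_cast ArithmeticFunction.abs_moebius_le_one
    have hχ : ‖χ (x.1 : ZMod D)‖ ≤ 1 := DirichletCharacter.norm_le_one χ _
    calc ‖(ArithmeticFunction.moebius x.1 : ℂ)‖ * ‖χ (x.1 : ZMod D)‖ * ‖divisorSumChar χ x.2‖
        ≤ 1 * 1 * ‖divisorSumChar χ x.2‖ := by gcongr
      _ = ‖divisorSumChar χ x.2‖ := by ring
  refine (Finset.sum_le_sum hterm).trans ?_
  -- reindex the pairs `(a,b)`, `b ≠ 1`, by `b`
  have hset : (e.divisorsAntidiagonal).erase (e, 1) =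
      (e.divisorsAntidiagonal).filter (fun x => x.2 ≠ 1) := by
    ext x
    simp only [Finset.mem_erase, Finset.mem_filter, ne_eq]
    constructor
    · rintro ⟨hne, hx⟩
      refine ⟨hx, fun h2 => hne ?_⟩
      obtain ⟨hxe, _⟩ := Nat.mem_divisorsAntidiagonal.mp hx
      ext
      · simpa [h2] using hxe
      · exact h2
    · rintro ⟨hx, h2⟩
      exact ⟨fun h => h2 (by rw [h]), hx⟩
  rw [hset, Finset.sum_filter,
    Nat.sum_divisorsAntidiagonal' (f := fun _ b => if b ≠ 1 then ‖divisorSumChar χ b‖ else 0),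
    ← Finset.sum_filter, Finset.filter_ne']

/-- `conj(n^{−ib}) = n^{ib}` for a natural `n` and real `b`. [folklore] -/
private theorem conj_natCast_cpow_negI' (b : ℝ) (n : ℕ) :
    conj ((n : ℂ) ^ (-(b * I))) = (n : ℂ) ^ ((b : ℂ) * I) := by
  have harg : (n : ℂ).arg ≠ π := by rw [Complex.natCast_arg]; exact Real.pi_pos.ne
  have h := Complex.conj_cpow (n : ℂ) ((b : ℂ) * I) harg
  rw [Complex.conj_natCast] at h
  rw [h]
  congr 2
  simp [Complex.conj_ofReal]

/-- `κ̄₂(m) = Σ_{(a,b): ab=m} a^{β₁}μ(b)` (`κ₂ = n^{−β₁} ∗ μ`, `β₁ = ib₁` purely imaginary).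
[cite: Zhang2022LandauSiegel, §17 p.97 (u016)] -/
theorem kappa2bar_eq_sum (c' : ℝ) (D : ℕ) (m : ℕ) :
    Typed.Section17.kappa2bar c' D m =
      ∑ x ∈ m.divisorsAntidiagonal, (x.1 : ℂ) ^ beta1 c' D * (ArithmeticFunction.moebius x.2 : ℂ) := by
  rw [Typed.Section17.kappa2bar, MeanSquareMajorant.kappa₂, ArithmeticFunction.mul_apply, map_sum]
  refine Finset.sum_congr rfl fun x hx => ?_
  have hx1 : x.1 ≠ 0 := by
    obtain ⟨hxm, hm⟩ := Nat.mem_divisorsAntidiagonal.mp hx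
    exact left_ne_zero_of_mul (hxm ▸ hm)
  have hb : beta1 c' D = ((b1 c' D : ℝ) : ℂ) * I := by
    simp only [beta1, b1]; push_cast; ring
  rw [map_mul, MeanSquareMajorant.powI_apply_of_ne_zero _ hx1, conj_natCast_cpow_negI',
    ArithmeticFunction.intCoe_apply, map_intCast, hb]

/-- `ϱ*₁(m) = Σ_{(a,b): ab=m} a^{β₁}χ(a)` ((15.21) at `j = 1`, over the divisor pairs).
[cite: Zhang2022LandauSiegel, §15 (15.21)] -/
theorem varrhoStar_one_eq_sum (c' : ℝ) (m : ℕ) :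
    varrhoStar c' χ 1 m =
      ∑ x ∈ m.divisorsAntidiagonal, (x.1 : ℂ) ^ beta1 c' D * χ (x.1 : ZMod D) := by
  rw [varrhoStar, Nat.sum_divisorsAntidiagonal (f := fun a _ => (a : ℂ) ^ beta1 c' D * χ (a : ZMod D))]
  refine Finset.sum_congr rfl fun d _ => ?_
  simp [betaJ]

/-- **The swap identity**: `χ(m)κ̄₂(m) − ϱ*₁(m) = Σ_{ab=m} a^{β₁}χ(a)·(μ(b)χ(b) − 1)` (`χ` completely
multiplicative). [cite: Zhang2022LandauSiegel, §17 p.98; App. B p.106] -/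
theorem chi_mul_kappa2bar_sub_varrhoStar_eq (c' : ℝ) (m : ℕ) :
    χ (m : ZMod D) * Typed.Section17.kappa2bar c' D m - varrhoStar c' χ 1 m =
      ∑ x ∈ m.divisorsAntidiagonal, (x.1 : ℂ) ^ beta1 c' D * χ (x.1 : ZMod D) *
        ((ArithmeticFunction.moebius x.2 : ℂ) * χ (x.2 : ZMod D) - 1) := by
  rw [kappa2bar_eq_sum, varrhoStar_one_eq_sum, Finset.mul_sum, ← Finset.sum_sub_distrib]
  refine Finset.sum_congr rfl fun x hx => ?_
  have hxm : x.1 * x.2 = m := (Nat.mem_divisorsAntidiagonal.mp hx).1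
  have hχ : χ (m : ZMod D) = χ (x.1 : ZMod D) * χ (x.2 : ZMod D) := by
    rw [← hxm, Nat.cast_mul, map_mul]
  rw [hχ]
  ring

/-- **The pointwise majorant**: for `m ≥ 1`,
`|χ(m)κ̄₂(m) − ϱ*₁(m)| ≤ Σ_{e∣m} Σ_{h∣e, h>1} |ν(h)|` (`|a^{β₁}χ(a)| ≤ 1`).
[cite: Zhang2022LandauSiegel, App. B p.106] -/
theorem norm_chi_mul_kappa2bar_sub_varrhoStar_le (c' : ℝ) {m : ℕ} (hm : m ≠ 0) :
    ‖χ (m : ZMod D) * Typed.Section17.kappa2bar c' D m - varrhoStar c' χ 1 m‖ ≤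
      ∑ e ∈ m.divisors, ∑ h ∈ e.divisors.erase 1, ‖divisorSumChar χ h‖ := by
  rw [chi_mul_kappa2bar_sub_varrhoStar_eq]
  refine (norm_sum_le _ _).trans ?_
  have hterm : ∀ x ∈ m.divisorsAntidiagonal,
      ‖(x.1 : ℂ) ^ beta1 c' D * χ (x.1 : ZMod D) *
          ((ArithmeticFunction.moebius x.2 : ℂ) * χ (x.2 : ZMod D) - 1)‖ ≤
        ∑ h ∈ x.2.divisors.erase 1, ‖divisorSumChar χ h‖ := by
    intro x hx
    obtain ⟨hxm, _⟩ := Nat.mem_divisorsAntidiagonal.mp hx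
    have hx1 : x.1 ≠ 0 := left_ne_zero_of_mul (hxm ▸ hm)
    have hx2 : x.2 ≠ 0 := right_ne_zero_of_mul (hxm ▸ hm)
    have hre : (beta1 c' D).re = 0 := by simp [beta1]
    have hpow : ‖(x.1 : ℂ) ^ beta1 c' D‖ = 1 := by
      rw [Complex.norm_natCast_cpow_of_pos (Nat.pos_of_ne_zero hx1), hre, Real.rpow_zero]
    rw [norm_mul, norm_mul, hpow, one_mul]
    calc ‖χ (x.1 : ZMod D)‖ * ‖(ArithmeticFunction.moebius x.2 : ℂ) * χ (x.2 : ZMod D) - 1‖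
        ≤ 1 * ‖(ArithmeticFunction.moebius x.2 : ℂ) * χ (x.2 : ZMod D) - 1‖ := by
          gcongr; exact DirichletCharacter.norm_le_one χ _
      _ ≤ ∑ h ∈ x.2.divisors.erase 1, ‖divisorSumChar χ h‖ := by
          rw [one_mul]; exact norm_moebius_mul_chi_sub_one_le χ hx2
  refine (Finset.sum_le_sum hterm).trans (le_of_eq ?_)
  exact Nat.sum_divisorsAntidiagonal' (f := fun _ b => ∑ h ∈ b.divisors.erase 1, ‖divisorSumChar χ h‖)

end Pointwise

end Literature.NumberTheory.LFunctions.Zhang2022.Skeleton
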